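import Mathlib
import Summits.ValiantsHypothesis.ValiantsHypothesis.Theorems.RigidityForcesSymmetryRankRigidMinimalReprLaplaceFiveSeparatedCapture
import Summits.ValiantsHypothesis.ValiantsHypothesis.Theorems.RigidityForcesSymmetryRankRigidMinimalReprLaplaceFiveRelabel

/-!
# ValiantsHypothesis / RigidityForcesSymmetry — crux `LaplaceOptimalFive` (stmt-ValiantsHypothesis-24813), crux idea
`young-shadow` (K1) meets `separated-capture` (idea #8): **THE LAST `k = 4` FAMILY `K₃ ⊔ K₂ = {01, 02, 12, 34}` REDUCES TO THE
SYMMETRIC CAPTURE INEQUALITY**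

K1 (`SideSymLaplaceOptimalFive`) is a kernel theorem on every support with at most four distinct pair splits EXCEPT the
triangle-plus-edge `K₃ ⊔ K₂` (rigid types ✓ `LaplaceFivePropA.sideSym_fourPairSplits_rigid`, the 4-cycle ✓ `LaplaceFiveSumRigidC4.sideSym_C4`,
the star ✓ `LaplaceFiveStar.sideSym_starPairSplits`).  `K₃ ⊔ K₂` is a `{3,4}`-SEPARATED profile, so the capture mechanism of
✓ `LaplaceFiveSeparatedCapture.stub_obligation_captured` applies; in the SIDE-SYMMETRIC sector every short factor on a triangle cut
`{a,b}` is a SYMMETRIC function of its two letters, so the three triangle short spans consist of symmetric matrices.  Hence K1 on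
`K₃ ⊔ K₂` (and on every slot-relabelled copy) follows from the capture inequality RESTRICTED TO SYMMETRIC configurations:

* `CaptureIneqSym` — `CaptureIneq` (✓ `…SeparatedCaptureDefs`) with the extra hypotheses that `U₀₁, U₀₂, U₁₂` consist of
  symmetric matrices.  In polynomial currency (memo `pub/val-lit/lmr/NOTE-p4g17-24813-K32-symmetric-capture.md`): for subspaces
  `U₁, U₂, U₃` of quadrics in five letters, the square-free cubics of the form `x·(Q¹ + Q² + Q³)` with quadratic vector fields
  `Qⁱ ∈ U_i ⊗ V` whose pairwise differences are GRADIENT fields span at most `dim U₁ + dim U₂ + dim U₃` dimensions (the symmetric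
  agreement of the three `S₍₂,₁₎`-components of a captured obligation is the new constraint versus the general `CaptureIneq`).
* `captureIneqSym_of_captureIneq` — the general inequality implies the symmetric one.
* `separated_of_symCapture` — `CaptureIneqSym` ⇒ weight `≥ 120` for every exact cylindrical system on a `{3,4}`-separated pair
  profile whose TRIANGLE short factors are slot-symmetric (leaf factors and all long factors arbitrary); proof = ✓
  `stub_separated_of_capture` verbatim plus `shortSpan_symm`.
* `sideSym_K32canon_of_symCapture`, `sideSym_K32_of_symCapture` — K1 on `{01,02,12,34}` and on every placement
  `{π0 π1, π0 π2, π1 π2, π3 π4}`, conditionally on `CaptureIneqSym`.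

STATUS OF `CaptureIneqSym` (memo, this seat): PROVED for monomial configurations (a captured square-free monomial needs three
memberships `m / x_r ∈ U_i`, each pair monomial serves at most three cubics); verified exactly on ≈ 10⁶ monomial and ≈ 10⁵ structured
configurations (0 violations; equality only at equal spans of disjoint pair monomials); OPEN in general.

Honest framing.  CONDITIONAL helper rows: `CaptureIneqSym` is OPEN, so nothing here closes K1 on `K₃ ⊔ K₂`; `LaplaceOptimalFive`
(OPEN · CONTESTED 72/120), S2′, `RankRigidMinimalRepr`, `VP ≠ VNP` are NOT proved.  One definition (`CaptureIneqSym`), no `sorry`;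
Mathlib + tree only.
-/

set_option linter.dupNamespace false
set_option autoImplicit false

namespace Summit.ValiantsHypothesis.ValiantsHypothesis.Theorems.RigidityForcesSymmetryRankRigidMinimalRepr

namespace LaplaceFiveSeparatedCapture

open Finset LaplaceFiveSectorSplit

/-- **THE SYMMETRIC 3-SLOT CAPTURE INEQUALITY.**  As `CaptureIneq`, but the three triangle configuration spaces `U₀₁, U₀₂, U₁₂`
consist of SYMMETRIC `5 × 5` matrices (the short spans of a side-symmetric system).  If every obligation `P₅ ⌞ μ`, `μ` in a space
`W` of symmetric zero-diagonal leaf matrices, is captured by `L3 U₀₁ U₀₂ U₁₂`, then `dim W ≤ dim U₀₁ + dim U₀₂ + dim U₁₂`.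
OPEN (proved for monomial configurations; no violation among ≈ 10⁶ exact tests); implied by `CaptureIneq`
(`captureIneqSym_of_captureIneq`); implies K1 on `K₃ ⊔ K₂` (`sideSym_K32_of_symCapture`). -/
def CaptureIneqSym : Prop :=
  ∀ (U01 U02 U12 W : Submodule ℂ (Fin 5 → Fin 5 → ℂ)),
    (∀ x ∈ U01, ∀ p q : Fin 5, x p q = x q p) → (∀ x ∈ U02, ∀ p q : Fin 5, x p q = x q p) →
    (∀ x ∈ U12, ∀ p q : Fin 5, x p q = x q p) →
    (∀ μ ∈ W, ∀ s t : Fin 5, μ s t = μ t s) → (∀ μ ∈ W, ∀ s : Fin 5, μ s s = 0) →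
    (∀ μ ∈ W, contractZ μ ∈ L3 U01 U02 U12) →
    Module.finrank ℂ W ≤ Module.finrank ℂ U01 + Module.finrank ℂ U02 + Module.finrank ℂ U12

/-- The general capture inequality implies the symmetric one (drop the symmetry hypotheses). [folklore] -/
theorem captureIneqSym_of_captureIneq (h : CaptureIneq) : CaptureIneqSym :=
  fun U01 U02 U12 W _ _ _ hWs hWd hWc => h U01 U02 U12 W hWs hWd hWc

/-- A short factor invariant under the transposition of its two slots `a ≠ b` has a symmetric `short2` matrix. [folklore] -/
theorem short2_symm (f : (Fin 5 → Fin 5) → ℂ) (a b : Fin 5) (hab : a ≠ b)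
    (hf : ∀ v : Fin 5 → Fin 5, f (v ∘ ⇑(Equiv.swap a b)) = f v) (p q : Fin 5) :
    short2 f a b p q = short2 f a b q p := by
  unfold short2
  have key : (Function.update (Function.update (fun _ : Fin 5 => (0 : Fin 5)) a q) b p) ∘ ⇑(Equiv.swap a b)
      = Function.update (Function.update (fun _ : Fin 5 => (0 : Fin 5)) a p) b q := by
    funext i
    simp only [Function.comp_apply]
    by_cases hib : i = b
    · subst hib
      rw [Equiv.swap_apply_right, Function.update_self, Function.update_of_ne hab, Function.update_self]
    · by_cases hia : i = a
      · subst hia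
        rw [Equiv.swap_apply_left, Function.update_of_ne hib, Function.update_self, Function.update_self]
      · rw [Equiv.swap_apply_of_ne_of_ne hia hib, Function.update_of_ne hib, Function.update_of_ne hia,
          Function.update_of_ne hib, Function.update_of_ne hia]
  rw [← key, hf]

/-- Hence the short span on a cut `{a, b}` (`a ≠ b`) consists of symmetric matrices as soon as every short factor filed on that
cut is invariant under the slot transposition `(a b)`. [folklore] -/
theorem shortSpan_symm {N : ℕ} (T : Finset (Fin N)) (S : Fin N → Finset (Fin 5)) (u : Fin N → (Fin 5 → Fin 5) → ℂ)
    (a b : Fin 5) (hab : a ≠ b)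
    (hu : ∀ t ∈ T, S t = ({a, b} : Finset (Fin 5)) → ∀ v : Fin 5 → Fin 5, u t (v ∘ ⇑(Equiv.swap a b)) = u t v) :
    ∀ x ∈ shortSpan T S u a b, ∀ p q : Fin 5, x p q = x q p := by
  intro x hx
  unfold shortSpan at hx
  refine Submodule.span_induction ?_ ?_ ?_ ?_ hx
  · rintro y ⟨t, ⟨ht, hSt⟩, rfl⟩ p q
    exact short2_symm (u t) a b hab (hu t ht hSt) p q
  · intro p q
    rfl
  · intro y z _ _ hy hz p q
    simp only [Pi.add_apply, hy p q, hz p q]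
  · intro r y _ hy p q
    simp only [Pi.smul_apply, hy p q]

/-- Slot-invariance on `{a, b}` gives invariance under the transposition `(a b)`. [folklore] -/
theorem swap_inv_of_slotInvariantOn (f : (Fin 5 → Fin 5) → ℂ) (a b : Fin 5)
    (h : SlotInvariantOn ({a, b} : Finset (Fin 5)) f) (v : Fin 5 → Fin 5) :
    f (v ∘ ⇑(Equiv.swap a b)) = f v := by
  refine h (Equiv.swap a b) (fun i hi => ?_) v
  simp only [Finset.mem_insert, Finset.mem_singleton, not_or] at hi
  exact Equiv.swap_apply_of_ne_of_ne hi.1 hi.2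

set_option maxHeartbeats 1600000 in
/-- **SYMMETRIC CAPTURE ⇒ weight `≥ 120` on every `{3,4}`-separated pair profile with slot-symmetric TRIANGLE short factors**
(leaf short factors and all long factors arbitrary; any multiplicities; off-shell allowed).  Proof = ✓ `stub_separated_of_capture`
verbatim, the symmetry of the three triangle short spans (`shortSpan_symm`) feeding the extra hypotheses of `CaptureIneqSym`. [folklore] -/
theorem separated_of_symCapture (hcap : CaptureIneqSym) :
    ∀ (N : ℕ) (T : Finset (Fin N)) (S : Fin N → Finset (Fin 5)) (u w : Fin N → (Fin 5 → Fin 5) → ℂ),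
      Cylindrical S u w → (∀ v : Fin 5 → Fin 5, (∑ t ∈ T, u t v * w t v) = perm5 v) → SepProfile34 T S →
      (∀ t ∈ T, S t ≠ ({3, 4} : Finset (Fin 5)) → SlotInvariantOn (S t) (u t)) →
      Nat.factorial 5 ≤ laplaceWeight T S := by
  intro N T S u w hc hex hsep hsymu
  classical
  /- (0) symmetry of the three triangle short spans -/
  have hsw : ∀ a b : Fin 5, a ≠ b → ({a, b} : Finset (Fin 5)) ≠ ({3, 4} : Finset (Fin 5)) →
      ∀ x ∈ shortSpan T S u a b, ∀ p q : Fin 5, x p q = x q p := by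
    intro a b hab h34
    refine shortSpan_symm T S u a b hab fun t ht hSt v => ?_
    have hinv := hsymu t ht (by rw [hSt]; exact h34)
    rw [hSt] at hinv
    exact swap_inv_of_slotInvariantOn (u t) a b hinv v
  have hs01 := hsw 0 1 (by decide) (by decide)
  have hs02 := hsw 0 2 (by decide) (by decide)
  have hs12 := hsw 1 2 (by decide) (by decide)
  /- (1) the profile is made of pair cuts: weight = 12·|T| and the four cut classes are disjoint in T -/
  have hweight : laplaceWeight T S = 12 * T.card := by
    unfold laplaceWeight
    rw [Finset.sum_congr rfl (g := fun _ => 12) ?_]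
    · simp [mul_comm]
    · intro t ht
      rcases hsep t ht with h | h | h | h <;> rw [h] <;> decide
  have hcount :
      (T.filter (fun t => S t = ({0, 1} : Finset (Fin 5)))).card
        + (T.filter (fun t => S t = ({0, 2} : Finset (Fin 5)))).card
        + (T.filter (fun t => S t = ({1, 2} : Finset (Fin 5)))).card
        + (T.filter (fun t => S t = ({3, 4} : Finset (Fin 5)))).card ≤ T.card := by
    rw [Finset.card_filter, Finset.card_filter, Finset.card_filter, Finset.card_filter,
      ← Finset.sum_add_distrib, ← Finset.sum_add_distrib, ← Finset.sum_add_distrib, Finset.card_eq_sum_ones T]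
    apply Finset.sum_le_sum
    intro t ht
    rcases hsep t ht with h | h | h | h <;> rw [h] <;> decide
  /- (2) spans are at most as big as the number of terms on the cut -/
  have hm : ∀ a b : Fin 5, Module.finrank ℂ (shortSpan T S u a b)
      ≤ (T.filter (fun t => S t = ({a, b} : Finset (Fin 5)))).card := by
    intro a b
    have hset : ((fun t => short2 (u t) a b) '' {t : Fin N | t ∈ T ∧ S t = ({a, b} : Finset (Fin 5))})
        = (((T.filter (fun t => S t = ({a, b} : Finset (Fin 5)))).image (fun t => short2 (u t) a b) :
            Finset (Fin 5 → Fin 5 → ℂ)) : Set (Fin 5 → Fin 5 → ℂ)) := by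
      ext x
      simp
    unfold shortSpan
    rw [hset]
    exact (finrank_span_finset_le_card _).trans Finset.card_image_le
  /- (3) coordinates for the symmetric zero-diagonal leaf matrices: an injective linear chart from ℂ^{10} -/
  let P := {x : Fin 5 × Fin 5 // x.1 < x.2}
  have hP : Fintype.card P = 10 := by decide
  let LsymFun : (P → ℂ) → (Fin 5 → Fin 5 → ℂ) := fun c s t =>
    if h : s < t then c ⟨(s, t), h⟩ else if h' : t < s then c ⟨(t, s), h'⟩ else 0
  let Lsym : (P → ℂ) →ₗ[ℂ] (Fin 5 → Fin 5 → ℂ) :=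
    { toFun := LsymFun
      map_add' := by
        intro c c'
        funext s t
        simp only [LsymFun, Pi.add_apply]
        split_ifs <;> simp
      map_smul' := by
        intro r c
        funext s t
        simp only [LsymFun, Pi.smul_apply, smul_eq_mul, RingHom.id_apply]
        split_ifs <;> simp }
  have hLsym_apply : ∀ c s t, Lsym c s t = LsymFun c s t := fun _ _ _ => rfl
  have hinj : Function.Injective Lsym := by
    intro c c' h
    funext π
    have := congr_fun (congr_fun h π.1.1) π.1.2
    simpa [hLsym_apply, LsymFun, π.2] using this
  have hsym : ∀ c (s t : Fin 5), Lsym c s t = Lsym c t s := by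
    intro c s t
    simp only [hLsym_apply, LsymFun]
    rcases lt_trichotomy s t with h | rfl | h
    · simp [h, not_lt.mpr h.le]
    · simp
    · simp [h, not_lt.mpr h.le]
  have hdiag : ∀ c (s : Fin 5), Lsym c s s = 0 := by
    intro c s
    simp [hLsym_apply, LsymFun]
  /- (4) the leaf evaluation map and its kernel (rank–nullity: dim ker ≥ 10 − n₃₄) -/
  let ev : (Fin 5 → Fin 5 → ℂ) →ₗ[ℂ] ((T.filter (fun t => S t = ({3, 4} : Finset (Fin 5)))) → ℂ) :=
    { toFun := fun M t => ∑ s : Fin 5, ∑ s' : Fin 5, M s s' * short2 (u t.1) 3 4 s s'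
      map_add' := by
        intro M M'
        funext t
        simp only [Pi.add_apply, add_mul, Finset.sum_add_distrib]
      map_smul' := by
        intro r M
        funext t
        simp only [Pi.smul_apply, smul_eq_mul, RingHom.id_apply, Finset.mul_sum, mul_assoc] }
  have hev_apply : ∀ M t, ev M t = ∑ s : Fin 5, ∑ s' : Fin 5, M s s' * short2 (u t.1) 3 4 s s' :=
    fun _ _ => rfl
  let ev' : (P → ℂ) →ₗ[ℂ] ((T.filter (fun t => S t = ({3, 4} : Finset (Fin 5)))) → ℂ) := ev ∘ₗ Lsym
  have hrn := LinearMap.finrank_range_add_finrank_ker ev'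
  rw [Module.finrank_fintype_fun_eq_card, hP] at hrn
  have hrange : Module.finrank ℂ (LinearMap.range ev')
      ≤ (T.filter (fun t => S t = ({3, 4} : Finset (Fin 5)))).card := by
    have := Submodule.finrank_le (LinearMap.range ev')
    rwa [Module.finrank_fintype_fun_eq_card, Fintype.card_coe] at this
  /- (5) the captured space W := Lsym (ker ev') and the symmetric capture inequality -/
  have hWK : Module.finrank ℂ ((LinearMap.ker ev').map Lsym) = Module.finrank ℂ (LinearMap.ker ev') :=
    (LinearEquiv.finrank_eq (Submodule.equivMapOfInjective Lsym hinj (LinearMap.ker ev'))).symm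
  have hcapW : Module.finrank ℂ ((LinearMap.ker ev').map Lsym)
      ≤ Module.finrank ℂ (shortSpan T S u 0 1) + Module.finrank ℂ (shortSpan T S u 0 2)
        + Module.finrank ℂ (shortSpan T S u 1 2) := by
    apply hcap _ _ _ _ hs01 hs02 hs12
    · intro μ hμ s t
      obtain ⟨c, -, rfl⟩ := Submodule.mem_map.1 hμ
      exact hsym c s t
    · intro μ hμ s
      obtain ⟨c, -, rfl⟩ := Submodule.mem_map.1 hμ
      exact hdiag c s
    · intro μ hμ
      obtain ⟨c, hcK, rfl⟩ := Submodule.mem_map.1 hμ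
      apply stub_obligation_captured N T S u w hc hex hsep
      intro t ht h34
      have h0 := congr_fun (LinearMap.mem_ker.1 hcK) ⟨t, Finset.mem_filter.2 ⟨ht, h34⟩⟩
      rw [Pi.zero_apply] at h0
      simpa [ev', hev_apply] using h0
  /- (6) count -/
  have h01 := hm 0 1
  have h02 := hm 0 2
  have h12 := hm 1 2
  have h5 : Nat.factorial 5 = 120 := by decide
  rw [h5, hweight]
  omega

/-- **K1 ON THE CANONICAL `K₃ ⊔ K₂ = {01, 02, 12, 34}`, CONDITIONALLY ON `CaptureIneqSym`.**  A side-symmetric split decomposition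
of `P₅` supported on the triangle `{0,1}, {0,2}, {1,2}` plus the disjoint edge `{3,4}` has Laplace weight `≥ 5! = 120`, provided the
symmetric capture inequality holds. [folklore] -/
theorem sideSym_K32canon_of_symCapture (hcap : CaptureIneqSym) {N : ℕ} (T : Finset (Fin N)) (S : Fin N → Finset (Fin 5))
    (u w : Fin N → (Fin 5 → Fin 5) → ℂ) (hdec : IsSplitDecomposition T S u w) (hsym : SideSymmetric T S u w)
    (hC : ∀ t ∈ T, S t = ({0, 1} : Finset (Fin 5)) ∨ S t = ({0, 2} : Finset (Fin 5)) ∨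
      S t = ({1, 2} : Finset (Fin 5)) ∨ S t = ({3, 4} : Finset (Fin 5))) :
    Nat.factorial 5 ≤ laplaceWeight T S := by
  refine separated_of_symCapture hcap N T S u w ⟨hdec.1, hdec.2.1⟩ ?_ hC fun t ht _ => (hsym t ht).1
  intro v
  rw [hdec.2.2 v]
  rfl

/-- **K1 ON EVERY PLACEMENT OF `K₃ ⊔ K₂`, CONDITIONALLY ON `CaptureIneqSym`**: splits `{π0,π1}, {π0,π2}, {π1,π2}, {π3,π4}` for any
slot permutation `π` (✓ `LaplaceFiveRelabel.weight_ge_of_relabel`). [folklore] -/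
theorem sideSym_K32_of_symCapture (hcap : CaptureIneqSym) {N : ℕ} (T : Finset (Fin N)) (S : Fin N → Finset (Fin 5))
    (u w : Fin N → (Fin 5 → Fin 5) → ℂ) (hdec : IsSplitDecomposition T S u w) (hsym : SideSymmetric T S u w)
    (π : Equiv.Perm (Fin 5))
    (hC : ∀ t ∈ T, S t = {π 0, π 1} ∨ S t = {π 0, π 2} ∨ S t = {π 1, π 2} ∨ S t = {π 3, π 4}) :
    Nat.factorial 5 ≤ laplaceWeight T S := by
  classical
  refine LaplaceFiveRelabel.weight_ge_of_relabel ({{0, 1}, {0, 2}, {1, 2}, {3, 4}} : Finset (Finset (Fin 5))) ?_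
    T S u w hdec hsym π⁻¹ ?_
  · intro N' T' S' u' w' hdec' hsym' hF
    refine sideSym_K32canon_of_symCapture hcap T' S' u' w' hdec' hsym' fun t ht => ?_
    have h := hF t ht
    simp only [Finset.mem_insert, Finset.mem_singleton] at h
    exact h
  · intro t ht
    have hinv : ∀ i : Fin 5, π⁻¹ (π i) = i := fun i => π.symm_apply_apply i
    rcases hC t ht with h | h | h | h <;> rw [h, LaplaceFiveRelabel.image_pair, hinv, hinv] <;> simp

end LaplaceFiveSeparatedCapture

end Summit.ValiantsHypothesis.ValiantsHypothesis.Theorems.RigidityForcesSymmetryRankRigidMinimalRepr
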